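import Mathlib
import Summits.Ventures.HodgeRepro2.T5CyclotomicSubfieldSexticCensus

/-!
# A NON-CYCLOTOMIC SEXTIC GALOIS CM FIELD: `F = ℚ(ζ₂₁)^{⟨σ₁₃⟩} = ℚ(√−3, ζ₇ + ζ₇⁻¹)`, ITS CENSUS BY `p mod 21`

Tier-5 support N2 / N3 / §G-N4.2 (seat p3, gen 81). The brief's «sextic Galois CM case» has so far been inhabited
on the cyclotomic fields `ℚ(ζ₇)` (files 264–277) and `ℚ(ζ₉)` (files 283–284). This file exhibits a sextic Galois CM
field that is NOT cyclotomic and runs the census of files 286–287 on it: inside `L = ℚ(ζ₂₁)` (degree `12`), let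
`σ₁₃ : ζ ↦ ζ¹³` (order `2`: `13² = 169 ≡ 1 mod 21`) and `F := L^{⟨σ₁₃⟩}` its fixed field. Then

* `finrank_fixedField`: `[F : ℚ] = 6`; `zmodSubgroup_eq`: `H_F = ⟨13⟩ ≤ (ℤ/21ℤ)ˣ`;
* `isTotallyComplex_fixedField`: `F` is totally complex (it contains `ω = ζ₂₁⁷`, a primitive cube root of unity,
  fixed by `σ₁₃` since `13 ≡ 1 mod 3`); hence `isCMField_fixedField`: `F` is a CM field, `isGalois_fixedField`;
* **`not_isCyclotomicExtension`**: `F` is not a cyclotomic field (`¬ IsCyclotomicExtension {n} ℚ F` for every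
  `n ≠ 0`): `13` splits completely in `F` (`13 ∈ H_F`), while in `ℚ(ζₙ)` it is ramified when `13 ∣ n` and has residue
  degree `ord_n(13)` otherwise, which is `1` only for `n ∣ 12` — and `φ(n) ≠ 6` for those `n`;
* the orders `ord(p · ⟨13⟩)` in `(ℤ/21ℤ)ˣ / ⟨13⟩` for `p = 2, 5, 13, 29, 41, 43, 97` (`6, 6, 1, 2, 2, 1, 1`), by two
  decidable checks each (`orderOf_mk_eq`); the census of `F` at these primes is file 289
  (`T5CyclotomicTwentyOneCensus`).

§8(d): uses an L-value-free non-vanishing device: NO.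
-/

open NumberField IsCyclotomicExtension.Rat Ideal IsDedekindDomain IsDedekindDomain.HeightOneSpectrum
open Summit.Ventures.HodgeRepro2.T5CyclotomicSubfieldInertiaDeg
  Summit.Ventures.HodgeRepro2.T5CyclotomicSubfieldSexticCensus

namespace Summit.Ventures.HodgeRepro2.T5CyclotomicTwentyOneSextic

section Units

/-- `13` is prime to `21`. -/
theorem coprime_thirteen : Nat.Coprime 13 21 := by decide

/-- The unit `13 ∈ (ℤ/21ℤ)ˣ`. -/
def u13 : (ZMod 21)ˣ := ZMod.unitOfCoprime 13 coprime_thirteen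

/-- `(u13 : ℤ/21ℤ) = 13`. -/
theorem u13_val : (u13 : ZMod 21) = 13 := by
  rw [u13, ZMod.coe_unitOfCoprime]
  rfl

/-- `13² = 1` in `(ℤ/21ℤ)ˣ` (`169 = 8 · 21 + 1`). -/
theorem u13_sq : u13 ^ 2 = 1 := by
  rw [Units.ext_iff, Units.val_pow_eq_pow_val, u13_val, Units.val_one]
  decide

/-- `u13 ≠ 1`. -/
theorem u13_ne_one : u13 ≠ 1 := by
  intro h
  rw [Units.ext_iff, u13_val, Units.val_one] at h
  exact absurd h (by decide)

/-- `orderOf u13 = 2`. -/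
theorem orderOf_u13 : orderOf u13 = 2 :=
  orderOf_eq_prime u13_sq u13_ne_one

/-- In any group, `x ∈ ⟨g⟩` with `g² = 1` iff `x = 1 ∨ x = g`. -/
theorem mem_zpowers_iff_of_sq_eq_one {G : Type*} [Group G] {g : G} (hg : g ^ 2 = 1) (x : G) :
    x ∈ Subgroup.zpowers g ↔ x = 1 ∨ x = g := by
  constructor
  · rintro ⟨k, rfl⟩
    show g ^ k = 1 ∨ g ^ k = g
    obtain ⟨r, hr | hr⟩ := Int.even_or_odd' k
    · left
      rw [hr, zpow_mul, zpow_ofNat, hg, one_zpow]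
    · right
      rw [hr, zpow_add, zpow_mul, zpow_ofNat, hg, one_zpow, one_mul, zpow_one]
  · rintro (rfl | rfl)
    · exact Subgroup.one_mem _
    · exact Subgroup.mem_zpowers _

/-- `(a · ⟨13⟩)^j = 1` in `(ℤ/21ℤ)ˣ / ⟨13⟩` iff `a^j ∈ {1, 13}` in `ℤ/21ℤ`. -/
theorem mk_pow_eq_one_iff (a : (ZMod 21)ˣ) (j : ℕ) :
    (QuotientGroup.mk a : (ZMod 21)ˣ ⧸ Subgroup.zpowers u13) ^ j = 1 ↔
      (a : ZMod 21) ^ j = 1 ∨ (a : ZMod 21) ^ j = 13 := by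
  rw [← QuotientGroup.mk_pow, QuotientGroup.eq_one_iff, mem_zpowers_iff_of_sq_eq_one u13_sq,
    Units.ext_iff, Units.ext_iff, Units.val_pow_eq_pow_val, Units.val_one, u13_val]

/-- **The order of `p · ⟨13⟩` in `(ℤ/21ℤ)ˣ / ⟨13⟩` from two decidable checks**: `p^k ∈ {1, 13}` and `p^j ∉ {1, 13}`
for `0 < j < k`. -/
theorem orderOf_mk_eq (p : ℕ) (hp : p.Coprime 21) (k : ℕ) (hk : 0 < k)
    (h1 : (p : ZMod 21) ^ k = 1 ∨ (p : ZMod 21) ^ k = 13)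
    (h2 : ∀ j ∈ Finset.Ico 1 k, ¬ ((p : ZMod 21) ^ j = 1 ∨ (p : ZMod 21) ^ j = 13)) :
    orderOf (QuotientGroup.mk (ZMod.unitOfCoprime p hp) : (ZMod 21)ˣ ⧸ Subgroup.zpowers u13) = k := by
  rw [orderOf_eq_iff hk]
  refine ⟨?_, ?_⟩
  · rw [mk_pow_eq_one_iff, ZMod.coe_unitOfCoprime]
    exact h1
  · intro j hjk hj h
    rw [mk_pow_eq_one_iff, ZMod.coe_unitOfCoprime] at h
    exact h2 j (Finset.mem_Ico.mpr ⟨hj, hjk⟩) h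

/-- Transport of `orderOf (a · H)` along an equality of subgroups. -/
theorem orderOf_mk_congr {G : Type*} [CommGroup G] {H H' : Subgroup G} (h : H = H') (a : G) :
    orderOf (QuotientGroup.mk a : G ⧸ H) = orderOf (QuotientGroup.mk a : G ⧸ H') := by
  subst h
  rfl

/-- `ord(2 · ⟨13⟩) = 6`. -/
theorem orderOf_mk_two :
    orderOf (QuotientGroup.mk (ZMod.unitOfCoprime 2 (by decide)) :
      (ZMod 21)ˣ ⧸ Subgroup.zpowers u13) = 6 :=
  orderOf_mk_eq 2 (by decide) 6 (by norm_num) (by decide) (by decide)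

/-- `ord(5 · ⟨13⟩) = 6`. -/
theorem orderOf_mk_five :
    orderOf (QuotientGroup.mk (ZMod.unitOfCoprime 5 (by decide)) :
      (ZMod 21)ˣ ⧸ Subgroup.zpowers u13) = 6 :=
  orderOf_mk_eq 5 (by decide) 6 (by norm_num) (by decide) (by decide)

/-- `ord(13 · ⟨13⟩) = 1`. -/
theorem orderOf_mk_thirteen :
    orderOf (QuotientGroup.mk (ZMod.unitOfCoprime 13 (by decide)) :
      (ZMod 21)ˣ ⧸ Subgroup.zpowers u13) = 1 :=
  orderOf_mk_eq 13 (by decide) 1 (by norm_num) (by decide) (by decide)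

/-- `ord(29 · ⟨13⟩) = 2` (`29 ≡ 8 mod 21`). -/
theorem orderOf_mk_twentyNine :
    orderOf (QuotientGroup.mk (ZMod.unitOfCoprime 29 (by decide)) :
      (ZMod 21)ˣ ⧸ Subgroup.zpowers u13) = 2 :=
  orderOf_mk_eq 29 (by decide) 2 (by norm_num) (by decide) (by decide)

/-- `ord(41 · ⟨13⟩) = 2` (`41 ≡ −1 mod 21`). -/
theorem orderOf_mk_fortyOne :
    orderOf (QuotientGroup.mk (ZMod.unitOfCoprime 41 (by decide)) :
      (ZMod 21)ˣ ⧸ Subgroup.zpowers u13) = 2 :=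
  orderOf_mk_eq 41 (by decide) 2 (by norm_num) (by decide) (by decide)

/-- `ord(43 · ⟨13⟩) = 1` (`43 ≡ 1 mod 21`). -/
theorem orderOf_mk_fortyThree :
    orderOf (QuotientGroup.mk (ZMod.unitOfCoprime 43 (by decide)) :
      (ZMod 21)ˣ ⧸ Subgroup.zpowers u13) = 1 :=
  orderOf_mk_eq 43 (by decide) 1 (by norm_num) (by decide) (by decide)

/-- `ord(97 · ⟨13⟩) = 1` (`97 ≡ 13 mod 21`: order `2` in `(ℤ/21ℤ)ˣ`, trivial modulo `⟨13⟩`). -/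
theorem orderOf_mk_ninetySeven :
    orderOf (QuotientGroup.mk (ZMod.unitOfCoprime 97 (by decide)) :
      (ZMod 21)ˣ ⧸ Subgroup.zpowers u13) = 1 :=
  orderOf_mk_eq 97 (by decide) 1 (by norm_num) (by decide) (by decide)

end Units

section Field

variable (L : Type*) [Field L] [NumberField L] [IsCyclotomicExtension {21} ℚ L]

/-- **`σ₁₃ : ζ ↦ ζ¹³`**, the automorphism of `ℚ(ζ₂₁)` attached to `13 ∈ (ℤ/21ℤ)ˣ` by Mathlib's `galEquivZMod`. -/
noncomputable def sigma : (L ≃ₐ[ℚ] L) := (galEquivZMod 21 L).symm u13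

/-- `galEquivZMod σ₁₃ = 13`. -/
theorem galEquivZMod_sigma : galEquivZMod 21 L (sigma L) = u13 :=
  (galEquivZMod 21 L).apply_symm_apply u13

/-- `σ₁₃² = 1`. -/
theorem sigma_sq : sigma L ^ 2 = 1 := by
  rw [sigma, ← map_pow, u13_sq, map_one]

/-- `orderOf σ₁₃ = 2`. -/
theorem orderOf_sigma : orderOf (sigma L) = 2 :=
  (orderOf_injective (galEquivZMod 21 L).symm.toMonoidHom (galEquivZMod 21 L).symm.injective u13).trans
    orderOf_u13

/-- **THE FIELD `F = ℚ(ζ₂₁)^{⟨σ₁₃⟩}`** — a non-cyclotomic sextic Galois CM field (`= ℚ(√−3, ζ₇ + ζ₇⁻¹)`). -/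
noncomputable def fixedField : IntermediateField ℚ L :=
  IntermediateField.fixedField (Subgroup.zpowers (sigma L))

/-- `Gal(ℚ(ζ₂₁)/F) = ⟨σ₁₃⟩` (the Galois correspondence). -/
theorem fixingSubgroup_fixedField : (fixedField L).fixingSubgroup = Subgroup.zpowers (sigma L) :=
  IntermediateField.fixingSubgroup_fixedField _

/-- **`H_F = ⟨13⟩ ≤ (ℤ/21ℤ)ˣ`**: the subgroup of file 286 cutting out `F`. -/
theorem zmodSubgroup_eq : zmodSubgroup 21 L (fixedField L) = Subgroup.zpowers u13 := by
  unfold zmodSubgroup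
  rw [fixingSubgroup_fixedField]
  change Subgroup.map (galEquivZMod 21 L).toMonoidHom (Subgroup.zpowers (sigma L)) = _
  rw [MonoidHom.map_zpowers]
  simp only [MulEquiv.coe_toMonoidHom]
  rw [galEquivZMod_sigma]

/-- `[ℚ(ζ₂₁) : F] = 2`. -/
theorem finrank_fixedField_top : Module.finrank (fixedField L) L = 2 := by
  rw [fixedField, IntermediateField.finrank_fixedField_eq_card, Nat.card_zpowers, orderOf_sigma]

/-- `φ(21) = 12`. -/
theorem totient_twentyOne : Nat.totient 21 = 12 := by decide

/-- `[ℚ(ζ₂₁) : ℚ] = 12`. -/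
theorem finrank_cyclotomic : Module.finrank ℚ L = 12 := by
  rw [IsCyclotomicExtension.Rat.finrank 21 L, totient_twentyOne]

/-- **`[F : ℚ] = 6`**. -/
theorem finrank_fixedField : Module.finrank ℚ (fixedField L) = 6 := by
  have h := Module.finrank_mul_finrank ℚ (fixedField L) L
  rw [finrank_fixedField_top, finrank_cyclotomic L] at h
  omega

/-- `ω := ζ₂₁⁷` is a primitive cube root of unity lying in `F` (`σ₁₃ ω = ω¹³ = ω`). -/
theorem exists_isPrimitiveRoot_three_mem : ∃ ω : L, IsPrimitiveRoot ω 3 ∧ ω ∈ fixedField L := by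
  have hζ := IsCyclotomicExtension.zeta_spec 21 ℚ L
  set ζ := IsCyclotomicExtension.zeta 21 ℚ L with hζdef
  have hω : IsPrimitiveRoot (ζ ^ 7) 3 := hζ.pow (by norm_num) (by norm_num)
  refine ⟨ζ ^ 7, hω, ?_⟩
  rw [fixedField, IntermediateField.mem_fixedField_iff]
  intro f hf
  rw [mem_zpowers_iff_of_sq_eq_one (sigma_sq L)] at hf
  rcases hf with rfl | rfl
  · rfl
  · rw [galEquivZMod_apply_of_pow_eq 21 L (sigma L) (by rw [← pow_mul, mul_comm, pow_mul, hζ.pow_eq_one, one_pow]),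
      galEquivZMod_sigma]
    have h13 : (u13 : ZMod 21).val = 13 := by rw [u13_val]; rfl
    rw [h13, show (13 : ℕ) = 3 * 4 + 1 from rfl, pow_succ, pow_mul, hω.pow_eq_one, one_pow, one_mul]

/-- **`F` is totally complex** (it contains `ℚ(ω)`, `ω` a primitive cube root of unity). -/
theorem isTotallyComplex_fixedField : IsTotallyComplex (fixedField L) := by
  obtain ⟨ω, hω, hωF⟩ := exists_isPrimitiveRoot_three_mem L
  have hEF : IntermediateField.adjoin ℚ {ω} ≤ fixedField L := by
    rw [IntermediateField.adjoin_le_iff]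
    simpa using hωF
  haveI : IsCyclotomicExtension {3} ℚ (IntermediateField.adjoin ℚ {ω}) :=
    hω.intermediateField_adjoin_isCyclotomicExtension ℚ
  haveI : IsTotallyComplex (IntermediateField.adjoin ℚ {ω}) :=
    IsCyclotomicExtension.Rat.isTotallyComplex (n := 3) _ (by norm_num)
  letI : Algebra (IntermediateField.adjoin ℚ {ω}) (fixedField L) :=
    (IntermediateField.inclusion hEF).toRingHom.toAlgebra
  exact isTotallyComplex_of_algebra (IntermediateField.adjoin ℚ {ω}) (fixedField L)

/-- **`F` is a CM field** (file 287 on a totally complex subfield of `ℚ(ζ₂₁)`). -/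
theorem isCMField_fixedField : IsCMField (fixedField L) :=
  haveI := isTotallyComplex_fixedField L
  isCMField_of_isTotallyComplex 21 L (fixedField L)

/-- `F` is Galois over `ℚ`. -/
theorem isGalois_fixedField : IsGalois ℚ (fixedField L) :=
  isGalois 21 L (fixedField L)

/-- `Gal(F/ℚ)` is cyclic (file 281: every sextic Galois CM field). -/
theorem isCyclic_gal_fixedField : IsCyclic ((fixedField L) ≃ₐ[ℚ] (fixedField L)) :=
  haveI := isCMField_fixedField L
  haveI := isGalois_fixedField L
  T5CMFieldCyclicGaloisCriterion.isCyclic_gal (fixedField L) (finrank_fixedField L)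

/-- `[F⁺ : ℚ] = 3` (`F⁺ = ℚ(ζ₇ + ζ₇⁻¹)`). -/
theorem finrank_maximalRealSubfield : Module.finrank ℚ (maximalRealSubfield (fixedField L)) = 3 :=
  haveI := isCMField_fixedField L
  T5CMFieldCyclicGaloisCriterion.finrank_maximalRealSubfield (fixedField L) (finrank_fixedField L)

end Field

section NotCyclotomic

variable (L : Type*) [Field L] [NumberField L] [IsCyclotomicExtension {21} ℚ L]

/-- `13` is unramified in `F`. -/
theorem ramificationIdx_thirteen (𝔭 : Ideal (𝓞 (fixedField L))) [𝔭.IsPrime]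
    [𝔭.LiesOver (span {(13 : ℤ)})] : 𝔭.ramificationIdx ℤ = 1 :=
  haveI : Fact (Nat.Prime 13) := ⟨by norm_num⟩
  T5CyclotomicUnramified.ramificationIdx_eq_one (m := 21) 13 L (fixedField L) (by decide) 𝔭

/-- **`13` splits completely in `F`**: `f(𝔭/13) = 1` (`13 ∈ H_F`). -/
theorem inertiaDeg_thirteen (𝔭 : Ideal (𝓞 (fixedField L))) [𝔭.IsPrime]
    [𝔭.LiesOver (span {(13 : ℤ)})] : 𝔭.inertiaDeg ℤ = 1 := by
  haveI : Fact (Nat.Prime 13) := ⟨by norm_num⟩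
  rw [inertiaDeg_eq_orderOf_mk 21 L (fixedField L) 13 (by decide) 𝔭,
    orderOf_mk_congr (zmodSubgroup_eq L)]
  exact orderOf_mk_thirteen

/-- `φ(n) ≠ 6` for every divisor `n` of `12`. -/
theorem totient_ne_six_of_dvd_twelve : ∀ n ∈ Nat.divisors 12, Nat.totient n ≠ 6 := by decide

/-- **`F` IS NOT A CYCLOTOMIC FIELD**: `¬ IsCyclotomicExtension {n} ℚ F` for every `n ≠ 0`. Proof: `13` splits
completely in `F`; in `ℚ(ζₙ)` it is ramified (`e = 13^k · 12`) when `13 ∣ n`, and has residue degree `ord_n(13)`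
otherwise, which is `1` only when `n ∣ 12` — but then `φ(n) ≠ 6 = [F : ℚ]`. -/
theorem not_isCyclotomicExtension (n : ℕ) [NeZero n] :
    ¬ IsCyclotomicExtension {n} ℚ (fixedField L) := by
  intro hn
  haveI : Fact (Nat.Prime 13) := ⟨by norm_num⟩
  haveI : (span {(13 : ℤ)}).IsMaximal := Int.ideal_span_isMaximal_of_prime 13
  obtain ⟨𝔭, h𝔭max, h𝔭13⟩ := Ideal.exists_ideal_over_maximal_of_isIntegral (S := 𝓞 (fixedField L))
    (span {(13 : ℤ)}) (by
      rw [(RingHom.injective_iff_ker_eq_bot _).mp (algebraMap ℤ (𝓞 (fixedField L))).injective_int]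
      exact bot_le)
  haveI : 𝔭.IsPrime := h𝔭max.isPrime
  haveI : 𝔭.LiesOver (span {(13 : ℤ)}) := ⟨h𝔭13.symm⟩
  have h6 : Nat.totient n = 6 := by
    rw [← IsCyclotomicExtension.Rat.finrank n (fixedField L), finrank_fixedField]
  by_cases h13 : 13 ∣ n
  · obtain ⟨e, n', hn', hne⟩ := Nat.exists_eq_pow_mul_and_not_dvd (NeZero.ne n) 13 (by norm_num)
    obtain ⟨k, rfl⟩ : ∃ k, e = k + 1 := by
      rcases e with _ | k
      · exfalso
        rw [pow_zero, one_mul] at hne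
        exact hn' (hne ▸ h13)
      · exact ⟨k, rfl⟩
    have he := IsCyclotomicExtension.Rat.ramificationIdx_eq n (fixedField L) 𝔭 hne hn'
    rw [ramificationIdx_thirteen] at he
    have : 1 ≤ 13 ^ k := Nat.one_le_pow _ _ (by norm_num)
    omega
  · have hf := IsCyclotomicExtension.Rat.inertiaDeg_eq_of_not_dvd 13 (fixedField L) 𝔭 h13
    rw [inertiaDeg_thirteen] at hf
    have h1 : ((13 : ℕ) : ZMod n) = ((1 : ℕ) : ZMod n) := by
      rw [Nat.cast_one]
      exact orderOf_eq_one_iff.mp hf.symm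
    have hdvd : n ∣ 12 := (Nat.modEq_iff_dvd' (by norm_num)).mp ((ZMod.natCast_eq_natCast_iff _ _ _).mp h1).symm
    exact totient_ne_six_of_dvd_twelve n (Nat.mem_divisors.mpr ⟨hdvd, by norm_num⟩) h6

end NotCyclotomic

end Summit.Ventures.HodgeRepro2.T5CyclotomicTwentyOneSextic
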